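/-
Copyright (c) 2026 the pub-hodgecm-mathlib formalisation cell (harness21).  Prover seat hodgecm-mathlib-K2E3-p23 (g2): Track B «K2-LIT», engine E3, line (ii′)
«H-side central germ expansion» — leaf (E) `sig_K2E3CentralGermExpansionExistence` PAID BY NAME; 2026-09-04.
-/
import Summits.HodgeConjecture.HodgeConjecture.Theorems.K2E3CentralGermExpansionExistenceOfRao            -- ★ p855998 (this seat): (E) ⟸ (RAO_z) + (DUAL_z)
import Summits.HodgeConjecture.HodgeConjecture.Theorems.K2E3CentralUnipotentOrbitalMeasuresOfConvergence  -- ★ p856062 (this seat): (RAO_z) ⟸ (RAO-CONV_z)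
import Summits.HodgeConjecture.HodgeConjecture.Theorems.K2E3CentralUnipotentDualPieces                   -- ★ p855937 (K2E4-p21 (g2)): (DUAL_z) PAID
import Literature.NumberTheory.Rogawski1990.UnitaryTwoOneCentralUnipotentOrbitalConvergenceOfCoreCM       -- ★ p856112 (this seat): (RAO-CONV_z) ⟸ ‹CORE_z›
import Literature.NumberTheory.Rogawski1990.UnitaryTwoOneCentralUnipotentOrbitFinitenessCM              -- ★∕pending p856153 (K2E5-p11 (g2)): ‹CORE_z› `UnitaryGroup.measure_preimage_descConj_lt_top_of_coe_eq_lineUnipotent_central` (the U(1,1) Iwasawa covering)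
import HarnessLib

/-!
# LEAF (E) `sig_K2E3CentralGermExpansionExistence` PAID BY NAME — the STABLE, CENTRED Shalika germ expansion on `H_v = U(Φ₂)(L⁺_v) × U(Φ₁)(L⁺_v)` along the elliptic
# `G`-regular filter at a central `z` (Rogawski 1990 §8.1 Prop. 8.1.1; Howe 1974; Ranga Rao 1972 — rank one × abelian, every non-split place, every residue characteristic)

Topic: cell `pub/hodgecm-mathlib` (D-0151), crux H413 = `stmt-HodgeConjecture-24833`; Track B «K2-LIT», engine E3 `K2_E3_EllipticInputs`, tier-1 unit `…Sigs_U3bCentralGerms`, line (ii′)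
«H-side central germ expansion with independent tails» (line lead K2E4-p06 (g2)), leaf **(E) `sig_K2E3CentralGermExpansionExistence`** (cand aea6e516723791cf, hosted VERBATIM, ED. 6 :163).
Namespace `Summit.HodgeConjecture.HodgeConjecture.Cruxes.H413.K2E3CentralGermExpansionExistence`.  THEOREMS ONLY (no definition, no instance, no notation, no `sorry`); kernel lane
`--supports stmt-HodgeConjecture-24833 --as helper`.  Seat K2E3-p23 (g2) — the CLOSER of the (E) programme: (E1) ★ p855739 ‹U-FIN₂› · (E2) ★ p855772 ∕ p855844 ∕ p855879 «STRATA₂» ·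
(E3) ★ p856037 «RAO-EX_z» + ★ p856079 ∕ p856112 (assembly of (RAO-CONV_z)) + ★ p856153 ‹CORE_z› (K2E5-p11 (g2), over ★ p856097) · (E4) ★ p855937 (DUAL_z) (K2E4-p21 (g2)) · (E5) ★ p855945
FAR_z + ★ p855998 (Howe's argument at `z`) · (RAO_z) payer ★ p856062.
HONEST LABEL: HC_CM is proved only modulo the 7 printed citations (2 remaining named inputs: hLiu418 = stmt-HodgeConjecture-24832, h413 = stmt-HodgeConjecture-24833) until rung 0
closes.  This file pays ONE tier-1 socket of the E3 line BY NAME (no antecedent, no named fact); it is a `--supports` helper — the crux h413 stays OPEN; REL ≠ ★ elsewhere.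

* **`centralGermExpansionExistence : ‹(E) sig_K2E3CentralGermExpansionExistence, VERBATIM›`** := ★ p855998 ∘ (★ p856062 ∘ ★ p856112 ∘ ★ p856153) ∘ ★ p855937 — the term of the
  HOME-only closure probe `K2/K2E3-p23/g2/Probe_ClosureE.HOMEONLY.lean` with `hcore := UnitaryGroup.measure_preimage_descConj_lt_top_of_coe_eq_lineUnipotent_central`.

## References
* [Rogawski1990] J. D. Rogawski, *Automorphic Representations of Unitary Groups in Three Variables*, Ann. of Math. Stud. 123 (1990): §8.1 Prop. 8.1.1 pp. 112–113, Prop. 8.1.2 (a)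
  p. 114; §3.9 p. 32; §4.3 (4.3.1) p. 43; §4.9 p. 54.
* [Howe1974] R. Howe, *The Fourier transform and germs of characters (case of Gl_n over a p-adic field)*, Math. Ann. 208 (1974) 305–322, Prop. 2.
* [Rao1972] R. Ranga Rao, *Orbital integrals in reductive groups*, Ann. of Math. (2) 96 (1972) 505–510.
* [HarishChandra1999AdmissibleDistributions] Harish-Chandra (DeBacker–Sally), *Admissible Invariant Distributions on Reductive p-adic Groups*, AMS ULS 16 (1999), Thm. 3.1, Thm. 8.1 p. 48.
-/

set_option autoImplicit false
set_option linter.dupNamespace false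

noncomputable section

open Filter Topology Set
open MeasureTheory Measure NumberField IsDedekindDomain
open Literature.MeasureTheory.Group Literature.MeasureTheory.RestrictedProduct
open Literature.Topology.RestrictedProduct Literature.Topology.Algebra.RestrictedProduct
open Literature.NumberTheory.Rogawski1990 Literature.NumberTheory.Automorphic
open Literature.AlgebraicGeometry.ShimuraVarieties (unitaryGroup hermForm)
open scoped Matrix MatrixGroups RestrictedProduct

namespace Summit.HodgeConjecture.HodgeConjecture.Cruxes.H413.K2E3CentralGermExpansionExistence

set_option maxHeartbeats 3200000 in
-- statement-heavy: the socket statement on the product carrier; the proof is a composition of ★ names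
/-- **(E) PAID BY NAME — THE STABLE, CENTRED SHALIKA GERM EXPANSION ON `H_v`** (statement = the hosted socket `sig_K2E3CentralGermExpansionExistence` VERBATIM): at a non-split `v`,
for every central `z ∈ H_v = U(Φ₂)(L⁺_v) × U(Φ₁)(L⁺_v)` there are finitely many classes `S ∋ ⟦z⟧` over `z`, an admissible family `mU` integrating `C_c^∞(H_v)` along them, and germs
`Γ_u` with `Φ^{st}_H(γ, fH) = Σ_{u∈S} Φ_{mU}(u, fH)·Γ_u(γ)` eventually along `𝓝[ell ∧ G-reg] z`, for every `fH ∈ C_c^∞(H_v)`.  := ★ `centralGermExpansionExistence_of_rao_of_dual`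
(Howe's argument at `z`) fed with ★ `centralUnipotentOrbitalMeasures_of_convergence` ∘ ★ `centralUnipotentOrbitalIntegrable_of_core` ∘ ★ K2E5-p11 (g2)'s core
`UnitaryGroup.measure_preimage_descConj_lt_top_of_coe_eq_lineUnipotent_central` (Ranga Rao by the `U(1,1)` Iwasawa covering) and ★ K2E4-p21 (g2)'s `centralUnipotentDualPieces`.
[cite: Rogawski1990, §8.1 Prop. 8.1.1 pp. 112–113; Prop. 8.1.2 (a) p. 114] [cite: Howe1974, Prop. 2] [cite: Rao1972, Theorem] [cite: HarishChandra1999AdmissibleDistributions, Thm. 3.1] -/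
theorem centralGermExpansionExistence :
    ∀ (L : Type) [Field L] [NumberField L] [IsCMField L] (H' : Matrix (Fin 3) (Fin 3) L),
      (H'.map (cmConjRingHom L)).transpose = H' →
      (∀ x : Fin 3 → L, hermForm (cmConjRingHom L) H' x x = 0 → x = 0) →
    ∀ (v : HeightOneSpectrum (𝓞 ↥(maximalRealSubfield L)))
      [MeasurableSpace ((UnitaryGroup.cmDatum L 2 (Matrix.of fun i j : Fin 2 => if i.val + j.val + 1 = 2 then (1 : L) else 0)).Local v × (UnitaryGroup.cmDatum L 1 (Matrix.of fun i j : Fin 1 => if i.val + j.val + 1 = 1 then (1 : L) else 0)).Local v)] [BorelSpace ((UnitaryGroup.cmDatum L 2 (Matrix.of fun i j : Fin 2 => if i.val + j.val + 1 = 2 then (1 : L) else 0)).Local v × (UnitaryGroup.cmDatum L 1 (Matrix.of fun i j : Fin 1 => if i.val + j.val + 1 = 1 then (1 : L) else 0)).Local v)]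
      [∀ a : (UnitaryGroup.cmDatum L 2 (Matrix.of fun i j : Fin 2 => if i.val + j.val + 1 = 2 then (1 : L) else 0)).Local v × (UnitaryGroup.cmDatum L 1 (Matrix.of fun i j : Fin 1 => if i.val + j.val + 1 = 1 then (1 : L) else 0)).Local v,
        MeasurableSpace (((UnitaryGroup.cmDatum L 2 (Matrix.of fun i j : Fin 2 => if i.val + j.val + 1 = 2 then (1 : L) else 0)).Local v × (UnitaryGroup.cmDatum L 1 (Matrix.of fun i j : Fin 1 => if i.val + j.val + 1 = 1 then (1 : L) else 0)).Local v) ⧸ Subgroup.centralizer ({a} : Set ((UnitaryGroup.cmDatum L 2 (Matrix.of fun i j : Fin 2 => if i.val + j.val + 1 = 2 then (1 : L) else 0)).Local v × (UnitaryGroup.cmDatum L 1 (Matrix.of fun i j : Fin 1 => if i.val + j.val + 1 = 1 then (1 : L) else 0)).Local v)))]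
      [∀ a : (UnitaryGroup.cmDatum L 2 (Matrix.of fun i j : Fin 2 => if i.val + j.val + 1 = 2 then (1 : L) else 0)).Local v × (UnitaryGroup.cmDatum L 1 (Matrix.of fun i j : Fin 1 => if i.val + j.val + 1 = 1 then (1 : L) else 0)).Local v,
        BorelSpace (((UnitaryGroup.cmDatum L 2 (Matrix.of fun i j : Fin 2 => if i.val + j.val + 1 = 2 then (1 : L) else 0)).Local v × (UnitaryGroup.cmDatum L 1 (Matrix.of fun i j : Fin 1 => if i.val + j.val + 1 = 1 then (1 : L) else 0)).Local v) ⧸ Subgroup.centralizer ({a} : Set ((UnitaryGroup.cmDatum L 2 (Matrix.of fun i j : Fin 2 => if i.val + j.val + 1 = 2 then (1 : L) else 0)).Local v × (UnitaryGroup.cmDatum L 1 (Matrix.of fun i j : Fin 1 => if i.val + j.val + 1 = 1 then (1 : L) else 0)).Local v)))]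
      [MeasurableSpace ((UnitaryGroup.cmDatum L 3 H').Local v)] [BorelSpace ((UnitaryGroup.cmDatum L 3 H').Local v)]
      [∀ γ : (UnitaryGroup.cmDatum L 3 H').Local v, MeasurableSpace ((UnitaryGroup.cmDatum L 3 H').Local v ⧸ Subgroup.centralizer ({γ} : Set ((UnitaryGroup.cmDatum L 3 H').Local v)))]
      [∀ γ : (UnitaryGroup.cmDatum L 3 H').Local v, BorelSpace ((UnitaryGroup.cmDatum L 3 H').Local v ⧸ Subgroup.centralizer ({γ} : Set ((UnitaryGroup.cmDatum L 3 H').Local v)))]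
      (νHv : Measure ((UnitaryGroup.cmDatum L 2 (Matrix.of fun i j : Fin 2 => if i.val + j.val + 1 = 2 then (1 : L) else 0)).Local v × (UnitaryGroup.cmDatum L 1 (Matrix.of fun i j : Fin 1 => if i.val + j.val + 1 = 1 then (1 : L) else 0)).Local v)) (νGv : Measure ((UnitaryGroup.cmDatum L 3 H').Local v))
      [IsFiniteMeasureOnCompacts νHv] [νHv.IsMulRightInvariant] [νGv.IsHaarMeasure] [νGv.IsMulRightInvariant]
      (Δv : LocalTransferFactor L H' v)
      (mHv : OrbitalMeasureFamily ((UnitaryGroup.cmDatum L 2 (Matrix.of fun i j : Fin 2 => if i.val + j.val + 1 = 2 then (1 : L) else 0)).Local v × (UnitaryGroup.cmDatum L 1 (Matrix.of fun i j : Fin 1 => if i.val + j.val + 1 = 1 then (1 : L) else 0)).Local v)) (mGv : OrbitalMeasureFamily ((UnitaryGroup.cmDatum L 3 H').Local v)),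
      IsLocalTransferDatum L H' v Δv mHv mGv →
      mHv.IsCanonical (IsLocalGRegular L v) νHv →
      mGv.IsCanonical (fun γ : (UnitaryGroup.cmDatum L 3 H').Local v => IsRegularElt (γ.val : GL (Fin 3) (UnitaryGroup.LocalRing L v))) νGv →
      Subsingleton (UnitaryGroup.PlacesOver L v) →
    ∀ z : (UnitaryGroup.cmDatum L 2 (Matrix.of fun i j : Fin 2 => if i.val + j.val + 1 = 2 then (1 : L) else 0)).Local v × (UnitaryGroup.cmDatum L 1 (Matrix.of fun i j : Fin 1 => if i.val + j.val + 1 = 1 then (1 : L) else 0)).Local v, z ∈ Subgroup.center ((UnitaryGroup.cmDatum L 2 (Matrix.of fun i j : Fin 2 => if i.val + j.val + 1 = 2 then (1 : L) else 0)).Local v × (UnitaryGroup.cmDatum L 1 (Matrix.of fun i j : Fin 1 => if i.val + j.val + 1 = 1 then (1 : L) else 0)).Local v) →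
    ∃ (S : Finset (ConjClasses ((UnitaryGroup.cmDatum L 2 (Matrix.of fun i j : Fin 2 => if i.val + j.val + 1 = 2 then (1 : L) else 0)).Local v × (UnitaryGroup.cmDatum L 1 (Matrix.of fun i j : Fin 1 => if i.val + j.val + 1 = 1 then (1 : L) else 0)).Local v))) (mU : OrbitalMeasureFamily ((UnitaryGroup.cmDatum L 2 (Matrix.of fun i j : Fin 2 => if i.val + j.val + 1 = 2 then (1 : L) else 0)).Local v × (UnitaryGroup.cmDatum L 1 (Matrix.of fun i j : Fin 1 => if i.val + j.val + 1 = 1 then (1 : L) else 0)).Local v))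
      (Γ : ConjClasses ((UnitaryGroup.cmDatum L 2 (Matrix.of fun i j : Fin 2 => if i.val + j.val + 1 = 2 then (1 : L) else 0)).Local v × (UnitaryGroup.cmDatum L 1 (Matrix.of fun i j : Fin 1 => if i.val + j.val + 1 = 1 then (1 : L) else 0)).Local v) → (UnitaryGroup.cmDatum L 2 (Matrix.of fun i j : Fin 2 => if i.val + j.val + 1 = 2 then (1 : L) else 0)).Local v × (UnitaryGroup.cmDatum L 1 (Matrix.of fun i j : Fin 1 => if i.val + j.val + 1 = 1 then (1 : L) else 0)).Local v → ℂ),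
      ConjClasses.mk z ∈ S ∧
      (∀ u ∈ S, ((((Quotient.out u * z⁻¹).1).val : GL (Fin 2) (UnitaryGroup.LocalRing L v)).val - 1) ^ 2 = 0 ∧ (Quotient.out u * z⁻¹).2 = 1) ∧
      mU.IsAdmissibleOn (fun γ : (UnitaryGroup.cmDatum L 2 (Matrix.of fun i j : Fin 2 => if i.val + j.val + 1 = 2 then (1 : L) else 0)).Local v × (UnitaryGroup.cmDatum L 1 (Matrix.of fun i j : Fin 1 => if i.val + j.val + 1 = 1 then (1 : L) else 0)).Local v => ConjClasses.mk γ ∈ S) ∧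
      (∀ u ∈ S, ∀ fH : (UnitaryGroup.cmDatum L 2 (Matrix.of fun i j : Fin 2 => if i.val + j.val + 1 = 2 then (1 : L) else 0)).Local v × (UnitaryGroup.cmDatum L 1 (Matrix.of fun i j : Fin 1 => if i.val + j.val + 1 = 1 then (1 : L) else 0)).Local v → ℂ, IsLocSmooth fH →
        Integrable (descConj (Quotient.out u : (UnitaryGroup.cmDatum L 2 (Matrix.of fun i j : Fin 2 => if i.val + j.val + 1 = 2 then (1 : L) else 0)).Local v × (UnitaryGroup.cmDatum L 1 (Matrix.of fun i j : Fin 1 => if i.val + j.val + 1 = 1 then (1 : L) else 0)).Local v) (Subgroup.centralizer ({(Quotient.out u : (UnitaryGroup.cmDatum L 2 (Matrix.of fun i j : Fin 2 => if i.val + j.val + 1 = 2 then (1 : L) else 0)).Local v × (UnitaryGroup.cmDatum L 1 (Matrix.of fun i j : Fin 1 => if i.val + j.val + 1 = 1 then (1 : L) else 0)).Local v)} : Set ((UnitaryGroup.cmDatum L 2 (Matrix.of fun i j : Fin 2 => if i.val + j.val + 1 = 2 then (1 : L) else 0)).Local v × (UnitaryGroup.cmDatum L 1 (Matrix.of fun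 i j : Fin 1 => if i.val + j.val + 1 = 1 then (1 : L) else 0)).Local v)))
          (fun _ hg => Subgroup.mem_centralizer_singleton_iff.1 hg) fH) (mU u)) ∧
      (∀ fH : (UnitaryGroup.cmDatum L 2 (Matrix.of fun i j : Fin 2 => if i.val + j.val + 1 = 2 then (1 : L) else 0)).Local v × (UnitaryGroup.cmDatum L 1 (Matrix.of fun i j : Fin 1 => if i.val + j.val + 1 = 1 then (1 : L) else 0)).Local v → ℂ, IsLocSmooth fH → ∀ᶠ γ in 𝓝[{γ : (UnitaryGroup.cmDatum L 2 (Matrix.of fun i j : Fin 2 => if i.val + j.val + 1 = 2 then (1 : L) else 0)).Local v × (UnitaryGroup.cmDatum L 1 (Matrix.of fun i j : Fin 1 => if i.val + j.val + 1 = 1 then (1 : L) else 0)).Local v |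
            IsLocalGRegular L v γ ∧ CompactSpace (Subgroup.centralizer ({γ} : Set ((UnitaryGroup.cmDatum L 2 (Matrix.of fun i j : Fin 2 => if i.val + j.val + 1 = 2 then (1 : L) else 0)).Local v × (UnitaryGroup.cmDatum L 1 (Matrix.of fun i j : Fin 1 => if i.val + j.val + 1 = 1 then (1 : L) else 0)).Local v)))}] z,
          stableOrbitalIntegralRel (IsLocalStablyConjH L v) mHv fH γ = ∑ u ∈ S, classOrbitalIntegral mU fH u * Γ u γ)  :=
  Summit.HodgeConjecture.HodgeConjecture.Cruxes.H413.K2E3CentralGermExpansionExistenceOfRao.centralGermExpansionExistence_of_rao_of_dual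
    (Summit.HodgeConjecture.HodgeConjecture.Cruxes.H413.K2E3CentralUnipotentOrbitalMeasuresOfConvergence.centralUnipotentOrbitalMeasures_of_convergence
      (Literature.NumberTheory.Rogawski1990.centralUnipotentOrbitalIntegrable_of_core
        Literature.NumberTheory.Rogawski1990.UnitaryGroup.measure_preimage_descConj_lt_top_of_coe_eq_lineUnipotent_central))
    Summit.HodgeConjecture.HodgeConjecture.Cruxes.H413.K2E3CentralUnipotentDualPieces.centralUnipotentDualPieces

end Summit.HodgeConjecture.HodgeConjecture.Cruxes.H413.K2E3CentralGermExpansionExistence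

end
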